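import Summits.QuantumFields.YangMills.Theorems.UnitScaleTiltProp7TrueLinLineBound
import Summits.QuantumFields.YangMills.Theorems.UnitScaleTiltProp7BondAvgIterCoercivity
import HarnessLib

/-!
# Route `UnitScaleTilt`, crux K1 «MinimiserStabilityRegPr» (stmt-QuantumFields-19200), route-R [RP] curved, the curved N6 row (R-C), transport geometry (iv) —
# THE `k`-BLOCK LINE COUNT: `Σ_c Σ_{x∈B^k(c₋)} Σ_{t<L^k} g(x + te_c, μ_c) = L^k·Σ_b g(b)`, AND THE `ℓ²` BOOKKEEPING OF ANY FUNCTIONAL DOMINATED TERMWISE BY THE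
# `k`-BLOCK LINE MASSES: `‖F(c)‖ ≤ δ·Σ_{x,t}‖Y(x+te_c, μ_c)‖ ⇒ Σ_c‖F(c)‖² ≤ δ²·(L^k)^{d+2}·Σ_b‖Y(b)‖²`

Cell `ym3-torus`, width seat `ym-ust-20520-w2` (g3).  The `ℓ²` step of the last part of (R-C) (`S_k ↔ A^{U₀}` of ✓ p601741): once the pure `LINE`-iterate `S_k(c)` and the
engine's penalty summand `ℓ^{−d}·A^{U₀}_c` are both written as sums over the one-stroke index set `(x ∈ B^k(c₋), t < L^k)` with transports differing by `O(ε)`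
(Steps A–C: closed form, tower-vs-straight transporters ⧗ `…TowerStraightTransport`, lattice Stokes), THIS file turns the termwise bound into the consumer's row
`Σ_cE_c² ≤ c_E·ℓ⁵ε²Σ‖Y‖²` (`δ = Cε·ℓ^{−d}`, d = 3: `δ²ℓ^{d+2} = C²ε²ℓ^{−1}`, `E_c = ℓ³‖·‖`).  Generalises ✓ p606827's one-level `sum_coarse_offsets_shifts` to `k` levels
(`Prop7FlatCoercivity.sum_fibre_eq_sum_offsets`, `Site.fibreEquiv`).  THEOREMS ONLY (0 `def`, 0 `sorry`); `--supports stmt-QuantumFields-19200`, count-neutral.  YM₃ on T³ is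
a ladder rung (R3), not the Clay problem; nothing here claims the curved N6, S2, P, the crux or the gap.

WHAT IS PROVED (ns `…Theorems.Prop7BlockLineCount`).
* §1 `sum_site_eq_sum_fibreSite` — `Σ_x G(x) = Σ_y Σ_r G(fibreSite 0 k y r)` (standing range `|T⁰| = L^k|T^k|` per direction).
* §2 ★ `sum_block_lines` — the title count (the one-stroke reparametrisation is `L^k`-to-one).
* §3 ★★ `sum_normSq_le_of_blockLine_bound` — termwise domination by the block line masses ⇒ the `ℓ²` row with constant `δ²(L^k)^{d+2}` (Cauchy–Schwarz over the
  `(L^k)^{d+1}` terms, then §2).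
HONEST SCOPE.  Pure lattice bookkeeping; no transports, no curvature.

References: T. Bałaban, CMP 95 (1984) 17–40 [Balaban1984PropagatorsI] ((1.8), (1.18) pp.19–20).
-/

noncomputable section

open scoped BigOperators

namespace Summit.QuantumFields.YangMills.Theorems.Prop7BlockLineCount

open Literature.MathematicalPhysics.QuantumFieldTheory.Balaban1983to89
open Finset T4Continuum B1RG242Torus
open B10StarCount (sum_pbond)
open Summit.QuantumFields.YangMills.Theorems.Prop7FlatCoercivity (sum_fibre_eq_sum_offsets)
open Summit.QuantumFields.YangMills.Theorems.Prop7TrueLinLineBound (sum_shift_iterate)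

variable {P : Params} {k : ℕ}

/-! ## §1 Fibre decomposition of a fine sum -/

/-- `Σ_x G(x) = Σ_y Σ_r G(fibreSite 0 k y r)`: a sum over the finest torus is the sum over `k`-blocks of the sums over the `(L^k)^d` block offsets. [folklore] -/
theorem sum_site_eq_sum_fibreSite (h : P.sitesPerDir 0 = P.L ^ k * P.sitesPerDir k) {M : Type*} [AddCommMonoid M] (G : Site P 0 → M) :
    ∑ x : Site P 0, G x = ∑ y : Site P k, ∑ r : Fin P.d → Fin (P.L ^ k), G (Site.fibreSite 0 k y r) := by
  rw [← Finset.sum_fiberwise_of_maps_to (s := Finset.univ) (t := Finset.univ) (g := Site.proj k k) (fun _ _ => Finset.mem_univ _) G]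
  exact Finset.sum_congr rfl fun y _ => sum_fibre_eq_sum_offsets h y G

/-! ## §2 ★ The `k`-block line count -/

/-- ★ **THE ONE-STROKE REPARAMETRISATION IS `L^k`-TO-ONE**: `Σ_c Σ_r Σ_{t<L^k} g⟨shift^t(fibreSite 0 k c₋ r), μ_c⟩ = L^k·Σ_b g(b)`. [cite: Balaban1984PropagatorsI, (1.18) p.20] -/
theorem sum_block_lines (h : P.sitesPerDir 0 = P.L ^ k * P.sitesPerDir k) (g : PBond P 0 → ℝ) :
    ∑ c : PBond P k, ∑ r : Fin P.d → Fin (P.L ^ k), ∑ t ∈ Finset.range (P.L ^ k),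
        g ⟨(fun z : Site P 0 => z.shift c.dir)^[t] (Site.fibreSite 0 k c.src r), c.dir⟩
      = ((P.L : ℝ) ^ k) * ∑ b : PBond P 0, g b := by
  rw [sum_pbond (fun c : PBond P k => ∑ r : Fin P.d → Fin (P.L ^ k), ∑ t ∈ Finset.range (P.L ^ k),
      g ⟨(fun z : Site P 0 => z.shift c.dir)^[t] (Site.fibreSite 0 k c.src r), c.dir⟩)]
  calc ∑ y : Site P k, ∑ μ : Fin P.d, ∑ r : Fin P.d → Fin (P.L ^ k), ∑ t ∈ Finset.range (P.L ^ k),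
          g ⟨(fun z : Site P 0 => z.shift μ)^[t] (Site.fibreSite 0 k y r), μ⟩
      = ∑ μ : Fin P.d, ∑ x : Site P 0, ∑ t ∈ Finset.range (P.L ^ k), g ⟨(fun z : Site P 0 => z.shift μ)^[t] x, μ⟩ := by
        rw [Finset.sum_comm]
        refine Finset.sum_congr rfl fun μ _ => ?_
        exact (sum_site_eq_sum_fibreSite h (fun x : Site P 0 => ∑ t ∈ Finset.range (P.L ^ k), g ⟨(fun z : Site P 0 => z.shift μ)^[t] x, μ⟩)).symm
    _ = ∑ μ : Fin P.d, ∑ t ∈ Finset.range (P.L ^ k), ∑ x : Site P 0, g ⟨(fun z : Site P 0 => z.shift μ)^[t] x, μ⟩ :=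
        Finset.sum_congr rfl fun μ _ => Finset.sum_comm
    _ = ∑ μ : Fin P.d, ∑ _t ∈ Finset.range (P.L ^ k), ∑ x : Site P 0, g ⟨x, μ⟩ := by
        refine Finset.sum_congr rfl fun μ _ => Finset.sum_congr rfl fun t _ => ?_
        exact sum_shift_iterate μ (fun x => g ⟨x, μ⟩) t
    _ = ((P.L : ℝ) ^ k) * ∑ b : PBond P 0, g b := by
        simp only [Finset.sum_const, Finset.card_range, nsmul_eq_mul, Nat.cast_pow]
        rw [← Finset.mul_sum, sum_pbond g]
        congr 1
        exact Finset.sum_comm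

/-! ## §3 ★★ `ℓ²` bookkeeping of a functional dominated by the block line masses -/

/-- ★★ **TERMWISE DOMINATION BY THE `k`-BLOCK LINE MASSES GIVES THE `ℓ²` ROW**: if `‖F(c)‖ ≤ δ·Σ_rΣ_{t<L^k}‖Y⟨shift^t(fibreSite 0 k c₋ r), μ_c⟩‖` for every level-`k`
bond `c`, then `Σ_c‖F(c)‖² ≤ δ²·((L^k)^d·L^k)·L^k·Σ_b‖Y(b)‖²` (Cauchy–Schwarz over the `(L^k)^{d+1}` one-stroke terms, then the `L^k`-to-one count).
[cite: Balaban1984PropagatorsI, (1.18) p.20] -/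
theorem sum_normSq_le_of_blockLine_bound (h : P.sitesPerDir 0 = P.L ^ k * P.sitesPerDir k)
    {E E' : Type*} [SeminormedAddCommGroup E] [SeminormedAddCommGroup E'] (F : PBond P k → E) (Y : PBond P 0 → E') {δ : ℝ}
    (hF : ∀ c : PBond P k, ‖F c‖ ≤ δ * ∑ r : Fin P.d → Fin (P.L ^ k), ∑ t ∈ Finset.range (P.L ^ k),
        ‖Y ⟨(fun z : Site P 0 => z.shift c.dir)^[t] (Site.fibreSite 0 k c.src r), c.dir⟩‖) :
    ∑ c : PBond P k, ‖F c‖ ^ 2 ≤ δ ^ 2 * ((((P.L : ℝ) ^ k) ^ P.d * (P.L : ℝ) ^ k) * (P.L : ℝ) ^ k) * ∑ b : PBond P 0, ‖Y b‖ ^ 2 := by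
  set A : PBond P k → (Fin P.d → Fin (P.L ^ k)) → ℕ → ℝ :=
    fun c r t => ‖Y ⟨(fun z : Site P 0 => z.shift c.dir)^[t] (Site.fibreSite 0 k c.src r), c.dir⟩‖ with hA
  -- Cauchy–Schwarz per coarse bond
  have hCS : ∀ c : PBond P k,
      (∑ r : Fin P.d → Fin (P.L ^ k), ∑ t ∈ Finset.range (P.L ^ k), A c r t) ^ 2
        ≤ (((P.L : ℝ) ^ k) ^ P.d * (P.L : ℝ) ^ k) * ∑ r : Fin P.d → Fin (P.L ^ k), ∑ t ∈ Finset.range (P.L ^ k), A c r t ^ 2 := by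
    intro c
    have h1 := sq_sum_le_card_mul_sum_sq (s := (Finset.univ : Finset (Fin P.d → Fin (P.L ^ k))) ×ˢ Finset.range (P.L ^ k)) (f := fun p => A c p.1 p.2)
    rw [Finset.sum_product, Finset.sum_product, Finset.card_product, Finset.card_univ, Fintype.card_fun, Fintype.card_fin, Fintype.card_fin,
      Finset.card_range] at h1
    push_cast at h1
    exact h1
  have hpt : ∀ c : PBond P k, ‖F c‖ ^ 2
      ≤ δ ^ 2 * (((P.L : ℝ) ^ k) ^ P.d * (P.L : ℝ) ^ k) * ∑ r : Fin P.d → Fin (P.L ^ k), ∑ t ∈ Finset.range (P.L ^ k), A c r t ^ 2 := by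
    intro c
    have h0 : 0 ≤ ∑ r : Fin P.d → Fin (P.L ^ k), ∑ t ∈ Finset.range (P.L ^ k), A c r t :=
      Finset.sum_nonneg fun r _ => Finset.sum_nonneg fun t _ => norm_nonneg _
    calc ‖F c‖ ^ 2 ≤ (δ * ∑ r : Fin P.d → Fin (P.L ^ k), ∑ t ∈ Finset.range (P.L ^ k), A c r t) ^ 2 :=
          pow_le_pow_left₀ (norm_nonneg _) (hF c) 2
      _ = δ ^ 2 * (∑ r : Fin P.d → Fin (P.L ^ k), ∑ t ∈ Finset.range (P.L ^ k), A c r t) ^ 2 := by ring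
      _ ≤ δ ^ 2 * ((((P.L : ℝ) ^ k) ^ P.d * (P.L : ℝ) ^ k) * ∑ r : Fin P.d → Fin (P.L ^ k), ∑ t ∈ Finset.range (P.L ^ k), A c r t ^ 2) :=
          mul_le_mul_of_nonneg_left (hCS c) (sq_nonneg _)
      _ = _ := by ring
  calc ∑ c : PBond P k, ‖F c‖ ^ 2
      ≤ ∑ c : PBond P k, δ ^ 2 * (((P.L : ℝ) ^ k) ^ P.d * (P.L : ℝ) ^ k) * ∑ r : Fin P.d → Fin (P.L ^ k), ∑ t ∈ Finset.range (P.L ^ k), A c r t ^ 2 :=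
        Finset.sum_le_sum fun c _ => hpt c
    _ = δ ^ 2 * (((P.L : ℝ) ^ k) ^ P.d * (P.L : ℝ) ^ k) * (((P.L : ℝ) ^ k) * ∑ b : PBond P 0, ‖Y b‖ ^ 2) := by
        rw [← Finset.mul_sum, sum_block_lines h (fun b : PBond P 0 => ‖Y b‖ ^ 2)]
    _ = δ ^ 2 * ((((P.L : ℝ) ^ k) ^ P.d * (P.L : ℝ) ^ k) * (P.L : ℝ) ^ k) * ∑ b : PBond P 0, ‖Y b‖ ^ 2 := by ring

end Summit.QuantumFields.YangMills.Theorems.Prop7BlockLineCount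

end
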